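import Summits.BirchSwinnertonDyer.BirchSwinnertonDyer.Theorems.EisensteinPrimesUnramifiedOutsideRamification
import Literature.NumberTheory.EllipticCurves.FineSelmerTorsionCoefficientsFiniteProofs
import Literature.NumberTheory.EllipticCurves.Kobayashi2003.FineSelmerLeSignedSelmerProofs
import HarnessLib

/-!
# Brink's reduction for the UNRAMIFIED condition at `v̄`: `conj_σ c` unramified at `v̄` for all `σ ∈ Γ_K` from the
# representatives `τ_i` (cell `bsd-eis`, seat `bsd-line-x1-p1` LEAD g4; crux 2 `GoodLatticeBDPValue`
# stmt-BirchSwinnertonDyer-19032, line `halves` v20, stub `stub_indexPlumbing` part (B): non-primitive vs strict at `v̄`)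

HONEST FRAMING (cell `bsd-eis`, run/shared/lean/pub/bsd-eis/): Galois-cohomology bookkeeping; no definition, no named fact,
no `sorry`, no `Theses` import; nothing about any curve is asserted; BSD / IMC2 / KY Thm. 1.4.1 are proved for NO curve.
Helper `--supports stmt-BirchSwinnertonDyer-19032`; closes no registered stub by itself.

## What
Over `L = K̄^H` (`H ⊴ Γ_K`), Greenberg–Vatsal's non-primitive Selmer group for Castella's BDP datum (strict datum
`M⁺_{v̄} = 0` at `v̄`, relaxed at `v`) imposes at `v̄` the condition «`conj_σ c ∈ unramifiedKer H M v̄` for EVERY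
`σ ∈ Γ_K`» (one condition per place of `L` above `v̄`), while the cell's signature device tests only the `p^c`
representatives `τ_i` (`κ(τ_i) = i`, `κ(D_v̄) = p^c ℤ_p`). x2-p2's `ResidualDevissageNonsplitLocalData.exists_reps_distinct_places`
reduces «all `σ`» to «the `τ_i`» for the STRICT condition `res_{H ⊓ D_v̄}(conj_σ c) = 0`; this file does the same for the
UNRAMIFIED (Greenberg) condition, which is what step (B) of `stub_indexPlumbing` (`corank Sel^{Sf}_{v̄}(𝟙̃) =
corank R(𝟙̃) + p^c`) needs to put the SUR classes inside the non-primitive group: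

* `conj_mem_inertia_of_mem_decomp` — `δ⁻¹ y δ ∈ I_v` for `δ ∈ D_v`, `y ∈ I_v` (`I(K̄_v/K_v) ⊴ Γ_{K_v}`);
* `conjH1_mem_unramifiedKer_of_mem_decomp` — `conj_δ` (`δ ∈ D_v`) preserves `unramifiedKer H M v` (on cocycles:
  `conj_δ φ = δ • φ(δ⁻¹ · δ)` is principal on `H ⊓ I_v` with `δ • t` when `φ` is with `t`);
* `conjH1_mem_of_reps` — the GENERIC reduction: for any set `P ⊆ H¹(ker κ, M)` stable under `conj_δ` (`δ ∈ D_v`), if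
  `κ(D_v) ∋ p^c` (exact-exponent currency of w5's `IndexInputsReps`, w3's SUR files) and `κ(τ_i) = i`, then
  `conj_{τ_i} x ∈ P` for `i < p^c` implies `conj_σ x ∈ P` for all `σ` (`σ = δ · τ_i · h`, `h ∈ ker κ` acts trivially);
* `conjH1_mem_unramifiedKer_of_reps` — the instance `P = unramifiedKer (ker κ) M v̄` (the strict instance is w5's
  `IndexInputsReps.resOfLe_conjH1_eq_zero_of_reps_of_pow_generates`, not restated).

References: [SerreGaloisCohomology1997] I §2.5, I §5.1 (conjugation on `H¹`); [GreenbergLNM1716] §1 (finitely decomposed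
primes), §3 Lemma 3.3; [Washington1997] §13.1 (closed subgroups of `ℤ_p`); [KellerYin2024] §1.1–1.2, Rem. 1.2.2
(arXiv:2402.12781v2) for the two local conditions at `𝔭̄`.
-/

-- D-0017: single-problem summit, the namespace repeats the problem name by design.
set_option linter.dupNamespace false
set_option autoImplicit false

noncomputable section

open scoped Classical

namespace Summit.BirchSwinnertonDyer.BirchSwinnertonDyer.Theorems.UnramifiedKerReps

open NumberField IsDedekindDomain Field Multiplicative
open Literature.NumberTheory.EllipticCurves Literature.NumberTheory.EllipticCurves.GreenbergSelmer
  Literature.NumberTheory.EllipticCurves.GreenbergVatsal2000 Literature.NumberTheory.GaloisRepresentations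
  Literature.NumberTheory.EllipticCurves.FineSelmerCoefficientMap
  Summit.BirchSwinnertonDyer.BirchSwinnertonDyer.Theorems.UnramifiedInflation

variable {K : Type} [Field K] [NumberField K]

/-! ## §1 Conjugation by the decomposition group preserves the unramified condition -/

/-- `I_v` is normalised by `D_v`: `δ⁻¹ y δ ∈ I_v` for `δ ∈ D_v`, `y ∈ I_v` (both are images of `Γ_{K_v}` resp. its
normal inertia subgroup under the restriction `Γ_{K_v} → Γ_K`). [cite: SerreLocalFields1979, IV §1 Prop. 1]
[cite: NeukirchANT1999, II §9 (9.6)] -/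
theorem conj_mem_inertia_of_mem_decomp (v : HeightOneSpectrum (𝓞 K)) {δ y : absoluteGaloisGroup K}
    (hδ : δ ∈ decomp (K := K) v) (hy : y ∈ inertia v) : δ⁻¹ * y * δ ∈ inertia v := by
  obtain ⟨d, rfl⟩ := (mem_decomp_iff v δ).mp hδ
  obtain ⟨ι, hι, rfl⟩ := Subgroup.mem_map.mp hy
  refine Subgroup.mem_map.mpr ⟨d⁻¹ * ι * d, ?_, by simp [map_mul, map_inv]⟩
  have h := (inferInstance : (absInertia (v.adicCompletion K)).Normal).conj_mem ι hι d⁻¹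
  rwa [inv_inv] at h

variable (H : Subgroup (absoluteGaloisGroup K)) [hN : H.Normal] (M : Type) [AddCommGroup M]
  [DistribMulAction (absoluteGaloisGroup K) M] [TopologicalSpace M] [DiscreteTopology M]

/-- **`conj_δ` preserves `GreenbergVatsal2000.unramifiedKer H M v` for `δ ∈ D_v`.** If the class `x ∈ H¹(H, M)` restricts to `0` on
`H ⊓ I_v` (a representing cocycle `φ` is `y ↦ y • t − t` there), then so does `conj_δ x`: its cocycle
`y ↦ δ • φ(δ⁻¹ y δ)` equals `y • (δ • t) − δ • t` on `H ⊓ I_v` (`δ⁻¹ y δ ∈ H ⊓ I_v` by normality of `H` and of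
`I_v` in `D_v`). [cite: SerreGaloisCohomology1997, I §5.1] [cite: GreenbergVatsal2000, §2 p. 17] -/
theorem conjH1_mem_unramifiedKer_of_mem_decomp (v : HeightOneSpectrum (𝓞 K)) {δ : absoluteGaloisGroup K}
    (hδ : δ ∈ decomp (K := K) v) {x : subgroupH1 H M} (hx : x ∈ GreenbergVatsal2000.unramifiedKer H M v) :
    conjH1 H M δ x ∈ GreenbergVatsal2000.unramifiedKer H M v := by
  obtain ⟨φ, rfl⟩ := oneCocycleClass_surjective _ x
  rw [GreenbergVatsal2000.unramifiedKer, AddMonoidHom.mem_ker, resH1Hom_oneCocycleClass, oneCocycleClass_eq_zero_iff] at hx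
  obtain ⟨t, ht⟩ := hx
  rw [conjH1_oneCocycleClass_mem_unramifiedKer_iff]
  refine ⟨δ • t, fun y ↦ ?_⟩
  -- the conjugate `δ⁻¹ y δ` as an element of `inertiaIn H v`
  have hy := (mem_inertiaIn_iff H v y).1 y.2
  have hyD : δ⁻¹ * ((y : decomp (K := K) v) : absoluteGaloisGroup K) * δ ∈ decomp (K := K) v :=
    (decomp v).mul_mem ((decomp v).mul_mem ((decomp v).inv_mem hδ) (y : decomp (K := K) v).2) hδ
  have hyH : δ⁻¹ * ((y : decomp (K := K) v) : absoluteGaloisGroup K) * δ ∈ H := by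
    have h := hN.conj_mem _ hy.1 δ⁻¹
    rwa [inv_inv] at h
  have hyI : δ⁻¹ * ((y : decomp (K := K) v) : absoluteGaloisGroup K) * δ ∈ inertia v :=
    conj_mem_inertia_of_mem_decomp v hδ hy.2
  let y' : inertiaIn H v := ⟨⟨_, hyD⟩, (mem_inertiaIn_iff H v _).2 ⟨hyH, hyI⟩⟩
  have h1 := ht y'
  rw [pullback_resHomOfEquivariant_apply, AddMonoidHom.id_apply] at h1
  have h1' : φ.1 (inertiaInToH H v y') =
      (δ⁻¹ * ((y : decomp (K := K) v) : absoluteGaloisGroup K) * δ) • t - t := h1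
  have h2 : subgroupConj H δ (inertiaInToH H v y) = inertiaInToH H v y' :=
    Subtype.ext (by rw [subgroupConj_apply_coe]; rfl)
  rw [h2, h1', smul_sub, smul_smul, ← mul_assoc, ← mul_assoc, mul_inv_cancel, one_mul, mul_smul]

/-! ## §2 The generic reduction to the representatives `τ_i` -/

section Reps

variable {p : ℕ} [Fact p.Prime] (κ : ZpExtension K p)

/-- **Brink's reduction, generic form.** Let `P ⊆ H¹(ker κ, M)` be stable under `conj_δ` for every `δ ∈ D_v`, let
`κ(δ₀) = p^c` for some `δ₀ ∈ D_v` (so `κ(D_v) ⊇ p^c ℤ_p`, `κ(D_v)` being closed), and let `κ(τ_i) = i`. If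
`conj_{τ_i} x ∈ P` for all `i < p^c` then `conj_σ x ∈ P` for every `σ ∈ Γ_K`: writing `κ(σ) = i + p^c z`
(`i < p^c`) and picking `δ ∈ D_v` with `κ(δ) = p^c z`, `σ = δ · τ_i · h` with `h ∈ ker κ`, and `conj_h = id` on
`H¹(ker κ, M)`. [cite: GreenbergLNM1716, §1 ("finitely decomposed")] [cite: Washington1997, §13.1]
[cite: SerreGaloisCohomology1997, I §5.1] -/
theorem conjH1_mem_of_reps (v : HeightOneSpectrum (𝓞 K)) {c : ℕ}
    (hc : ∃ δ ∈ decomp (K := K) v, (κ δ).toAdd = (p : ℤ_[p]) ^ c)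
    (M : Type) [AddCommGroup M] [DistribMulAction (absoluteGaloisGroup K) M] [TopologicalSpace M]
    [DiscreteTopology M] (P : Set (subgroupH1 κ.kerSubgroup M))
    (hP : ∀ δ ∈ decomp (K := K) v, ∀ x ∈ P, conjH1 κ.kerSubgroup M δ x ∈ P)
    (τ : ℕ → absoluteGaloisGroup K) (hτ : ∀ i, κ (τ i) = Multiplicative.ofAdd ((i : ℕ) : ℤ_[p]))
    (x : subgroupH1 κ.kerSubgroup M) (hx : ∀ i, i < p ^ c → conjH1 κ.kerSubgroup M (τ i) x ∈ P)
    (σ : absoluteGaloisGroup K) : conjH1 κ.kerSubgroup M σ x ∈ P := by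
  obtain ⟨δ₀, hδ₀D, hδ₀⟩ := hc
  -- the closed subgroup `Z = κ(D_v) ≤ ℤ_p`, containing `p^c`
  let Z : AddSubgroup ℤ_[p] :=
    AddSubgroup.toSubgroup.symm ((decomp (K := K) v).map
      (κ.toContinuousMonoidHom : absoluteGaloisGroup K →* Multiplicative ℤ_[p]))
  have hZmem : ∀ y : ℤ_[p], y ∈ Z ↔ ∃ δ ∈ decomp (K := K) v, κ δ = Multiplicative.ofAdd y := fun y ↦ by
    change Multiplicative.ofAdd y ∈ (decomp (K := K) v).map _ ↔ _
    rw [Subgroup.mem_map]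
    rfl
  have hZclosed : IsClosed (Z : Set ℤ_[p]) := by
    have hK : IsCompact (((decomp (K := K) v).map
        (κ.toContinuousMonoidHom : absoluteGaloisGroup K →* Multiplicative ℤ_[p]) :
        Subgroup (Multiplicative ℤ_[p])) : Set (Multiplicative ℤ_[p])) := by
      rw [Subgroup.coe_map]
      exact (Kobayashi2003.isCompact_decomp v).image κ.toContinuousMonoidHom.continuous
    exact hK.isClosed
  have huZ : (p : ℤ_[p]) ^ c ∈ Z := (hZmem _).mpr ⟨δ₀, hδ₀D, by rw [← hδ₀, ofAdd_toAdd]⟩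
  have hu0 : (p : ℤ_[p]) ^ c ≠ 0 := pow_ne_zero c PadicInt.irreducible_p.ne_zero
  have hval : ((p : ℤ_[p]) ^ c).valuation = c := by
    rw [PadicInt.valuation_pow, PadicInt.valuation_p, mul_one]
  -- write `κ σ = i + p^c z`, `i < p^c`
  set y : ℤ_[p] := (κ σ).toAdd with hy
  set i : ℕ := (PadicInt.toZModPow c y).val with hi
  have hi_lt : i < p ^ c := ZMod.val_lt _
  have hyi : y - i ∈ Ideal.span {(p : ℤ_[p]) ^ c} := by
    rw [← PadicInt.ker_toZModPow, RingHom.mem_ker, map_sub, map_natCast, hi, ZMod.natCast_zmod_val,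
      sub_self]
  obtain ⟨z, hz⟩ := Ideal.mem_span_singleton.mp hyi
  obtain ⟨δ, hδD, hδ⟩ := (hZmem _).mp
    (hz ▸ hval ▸ pow_valuation_mul_mem_of_isClosed Z hZclosed huZ hu0 z : y - i ∈ Z)
  -- `h = (δ τ_i)⁻¹ σ ∈ ker κ`
  have hh : (δ * τ i)⁻¹ * σ ∈ κ.kerSubgroup := by
    rw [ZpExtension.mem_kerSubgroup, map_mul, map_inv, map_mul, hδ, hτ i]
    apply Multiplicative.toAdd.injective
    rw [toAdd_mul, toAdd_inv, toAdd_mul, toAdd_ofAdd, toAdd_ofAdd, toAdd_one, ← hy]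
    ring
  have hσ : σ = δ * (τ i * ((δ * τ i)⁻¹ * σ)) := by group
  rw [hσ, conjH1_mul_holds, AddMonoidHom.comp_apply, conjH1_mul_holds, AddMonoidHom.comp_apply,
    conjH1_of_mem_holds κ.kerSubgroup M hh, AddMonoidHom.id_apply]
  exact hP δ hδD _ (hx i hi_lt)

/-- **Brink's reduction for the unramified condition at `v̄`.** With `κ(δ₀) = p^c` for some `δ₀ ∈ D_v̄` and
`κ(τ_i) = i`: if `conj_{τ_i} x` is unramified at `v̄` (`∈ GreenbergVatsal2000.unramifiedKer (ker κ) M v̄`) for all `i < p^c`, then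
`conj_σ x` is unramified at `v̄` for EVERY `σ ∈ Γ_K` — i.e. `x` satisfies Greenberg's condition of the BDP datum at
every place of `K_∞` above `v̄`. [cite: GreenbergVatsal2000, §2 pp. 16–17, 20] [cite: GreenbergLNM1716, §1]
[cite: KellerYin2024, §1.1–1.2 and Rem. 1.2.2 (arXiv:2402.12781v2)] -/
theorem conjH1_mem_unramifiedKer_of_reps (v : HeightOneSpectrum (𝓞 K)) {c : ℕ}
    (hc : ∃ δ ∈ decomp (K := K) v, (κ δ).toAdd = (p : ℤ_[p]) ^ c)
    (M : Type) [AddCommGroup M] [DistribMulAction (absoluteGaloisGroup K) M] [TopologicalSpace M]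
    [DiscreteTopology M]
    (τ : ℕ → absoluteGaloisGroup K) (hτ : ∀ i, κ (τ i) = Multiplicative.ofAdd ((i : ℕ) : ℤ_[p]))
    (x : subgroupH1 κ.kerSubgroup M)
    (hx : ∀ i, i < p ^ c → conjH1 κ.kerSubgroup M (τ i) x ∈ GreenbergVatsal2000.unramifiedKer κ.kerSubgroup M v)
    (σ : absoluteGaloisGroup K) : conjH1 κ.kerSubgroup M σ x ∈ GreenbergVatsal2000.unramifiedKer κ.kerSubgroup M v :=
  conjH1_mem_of_reps κ v hc M (GreenbergVatsal2000.unramifiedKer κ.kerSubgroup M v : Set (subgroupH1 κ.kerSubgroup M))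
    (fun _ hδ _ hx' ↦ conjH1_mem_unramifiedKer_of_mem_decomp κ.kerSubgroup M v hδ hx') τ hτ x hx σ

end Reps

end Summit.BirchSwinnertonDyer.BirchSwinnertonDyer.Theorems.UnramifiedKerReps

end
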